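import Summits.CriticalPhenomena.PercolationContinuityZ3.Theorems.SahiMasterFamilyFCombShiftDet
import Mathlib.Data.Finset.SymmDiff
import Mathlib.Order.SymmDiff

/-!
# Down-compressions: monotonicity in the family and invariance under coordinate flips (row `F`, support file)

Support file (lead seat `prim-nh-lead-4575`, gen 110; `--supports stmt-CriticalPhenomena-4575`); part of the formalisation of
prim-bnk-2 g21's hand proof of THEOREM F (`run/shared/lean/prim/prim-l12/prim-bnk-2/PROOF-F-inequality.md`, lemmas L1/L3 and §5).
No definitions, no `sorry`, standard axioms.
* `Shift.compression_mono` / `downs_mono` — Mathlib's `Finset.Down.compression` (and its iterate along a list) is monotone in the family;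
* `compression_image_symmDiff_self` (`D_c ∘ τ_c = D_c`), `compression_image_symmDiff` (`D_c ∘ τ_J = τ_J ∘ D_c` for `c ∉ J`);
* **`downs_image_symmDiff` / `downs_image_compl`** — σ-invariance of the full down-compression: `D_l(σX) = D_l X` whenever the
  duplicate-free list `l` contains every flipped coordinate (used for the containment `(♦♦)` behind THEOREM K, `…FCombShiftAllThird`).
[this work]
-/

namespace Summit.CriticalPhenomena.PercolationContinuityZ3.Theorems

namespace SahiFComb.Shift

open Finset FinsetFamily
open scoped symmDiff

variable {α : Type*} [DecidableEq α]


/-- Down-compression is monotone in the family (L1 of PROOF-F-inequality.md). [this work] -/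
theorem compression_mono {X Y : Finset (Finset α)} (h : X ⊆ Y) (a : α) : 𝓓 a X ⊆ 𝓓 a Y := by
  intro s hs
  rw [Down.mem_compression] at hs ⊢
  rcases hs with ⟨h1, h2⟩ | ⟨h1, h2⟩
  · exact Or.inl ⟨h h1, h h2⟩
  · have ha : a ∉ s := fun ha => h1 (by rwa [insert_eq_of_mem ha] at h2)
    by_cases hsY : s ∈ Y
    · exact Or.inl ⟨hsY, by rwa [erase_eq_of_notMem ha]⟩
    · exact Or.inr ⟨hsY, h h2⟩

/-- Iterated down-compression is monotone in the family. [this work] -/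
theorem downs_mono : ∀ (l : List α) {X Y : Finset (Finset α)}, X ⊆ Y →
    l.foldl (fun 𝒴 i => 𝓓 i 𝒴) X ⊆ l.foldl (fun 𝒴 i => 𝓓 i 𝒴) Y
  | [], _, _, h => h
  | i :: l, _, _, h => downs_mono l (compression_mono h i)

/-- Membership in a family flipped along `J` (every member replaced by its symmetric difference with `J`). [folklore] -/
theorem mem_image_symmDiff {X : Finset (Finset α)} {J s : Finset α} :
    s ∈ X.image (fun K => K ∆ J) ↔ s ∆ J ∈ X := by
  rw [mem_image]
  constructor
  · rintro ⟨K, hK, rfl⟩; rwa [symmDiff_symmDiff_cancel_right]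
  · intro h; exact ⟨s ∆ J, h, symmDiff_symmDiff_cancel_right _ _⟩

/-- Flipping the compressed coordinate itself does not change the down-compression (`D_c ∘ τ_c = D_c`). [this work] -/
theorem compression_image_symmDiff_self (c : α) (X : Finset (Finset α)) :
    𝓓 c (X.image (fun K => K ∆ {c})) = 𝓓 c X := by
  ext s
  simp only [Down.mem_compression, mem_image_symmDiff]
  by_cases hc : c ∈ s
  · have e1 : s ∆ {c} = s.erase c := by
      ext x; simp only [mem_symmDiff, mem_singleton, mem_erase]
      constructor
      · rintro (⟨h1, h2⟩ | ⟨rfl, h2⟩); exact ⟨h2, h1⟩; exact absurd hc h2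
      · rintro ⟨h1, h2⟩; exact Or.inl ⟨h2, h1⟩
    have e2 : s.erase c ∆ {c} = s := by
      ext x; simp only [mem_symmDiff, mem_singleton, mem_erase]
      constructor
      · rintro (⟨⟨-, h2⟩, -⟩ | ⟨rfl, -⟩); exact h2; exact hc
      · intro h; by_cases hx : x = c; exact Or.inr ⟨hx, fun h' => h'.1 hx⟩; exact Or.inl ⟨⟨hx, h⟩, hx⟩
    have e3 : insert c s = s := insert_eq_of_mem hc
    rw [e3, e1, e2]
    tauto
  · have e1 : s ∆ {c} = insert c s := by
      ext x; simp only [mem_symmDiff, mem_singleton, mem_insert]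
      constructor
      · rintro (⟨h1, -⟩ | ⟨rfl, -⟩); exact Or.inr h1; exact Or.inl rfl
      · rintro (rfl | h); exact Or.inr ⟨rfl, hc⟩; exact Or.inl ⟨h, fun h' => hc (h' ▸ h)⟩
    have e2 : s.erase c = s := erase_eq_of_notMem hc
    have e3 : insert c s ∆ {c} = s := by
      ext x; simp only [mem_symmDiff, mem_singleton, mem_insert]
      constructor
      · rintro (⟨rfl | h1, h2⟩ | ⟨rfl, h2⟩); exact absurd rfl h2; exact h1; exact absurd (Or.inl rfl) h2
      · intro h; exact Or.inl ⟨Or.inr h, fun h' => hc (h' ▸ h)⟩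
    rw [e2, e1, e3]
    tauto

/-- Flipping coordinates away from the compressed one commutes with the down-compression (`D_c ∘ τ_J = τ_J ∘ D_c`, `c ∉ J`).
[this work] -/
theorem compression_image_symmDiff {c : α} {J : Finset α} (hc : c ∉ J) (X : Finset (Finset α)) :
    𝓓 c (X.image (fun K => K ∆ J)) = (𝓓 c X).image (fun K => K ∆ J) := by
  ext s
  simp only [Down.mem_compression, mem_image_symmDiff]
  have e1 : s.erase c ∆ J = (s ∆ J).erase c := by
    ext x; simp only [mem_symmDiff, mem_erase]
    constructor
    · rintro (⟨⟨h1, h2⟩, h3⟩ | ⟨h1, h2⟩)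
      · exact ⟨h1, Or.inl ⟨h2, h3⟩⟩
      · exact ⟨fun h => hc (h ▸ h1), Or.inr ⟨h1, fun h => h2 ⟨fun h' => hc (h' ▸ h1), h⟩⟩⟩
    · rintro ⟨h1, ⟨h2, h3⟩ | ⟨h2, h3⟩⟩
      · exact Or.inl ⟨⟨h1, h2⟩, h3⟩
      · exact Or.inr ⟨h2, fun h => h3 h.2⟩
  have e2 : insert c s ∆ J = insert c (s ∆ J) := by
    ext x; simp only [mem_symmDiff, mem_insert]
    constructor
    · rintro (⟨rfl | h1, h2⟩ | ⟨h1, h2⟩)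
      · exact Or.inl rfl
      · exact Or.inr (Or.inl ⟨h1, h2⟩)
      · exact Or.inr (Or.inr ⟨h1, fun h => h2 (Or.inr h)⟩)
    · rintro (rfl | ⟨h1, h2⟩ | ⟨h1, h2⟩)
      · exact Or.inl ⟨Or.inl rfl, hc⟩
      · exact Or.inl ⟨Or.inr h1, h2⟩
      · exact Or.inr ⟨h1, by rintro (rfl | h); exact hc h1; exact h2 h⟩
  rw [e1, e2]

/-- **σ-invariance of iterated down-compression** (memo §5): flipping any set `J` of coordinates that all occur in the
(duplicate-free) compression list does not change the result, `D_l(τ_J X) = D_l X`. [this work] -/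
theorem downs_image_symmDiff : ∀ (l : List α), l.Nodup → ∀ (J : Finset α), (∀ j ∈ J, j ∈ l) →
    ∀ X : Finset (Finset α), l.foldl (fun 𝒴 i => 𝓓 i 𝒴) (X.image (fun K => K ∆ J)) = l.foldl (fun 𝒴 i => 𝓓 i 𝒴) X
  | [], _, J, hJ, X => by
    have : J = ∅ := eq_empty_of_forall_notMem fun j hj => by simpa using hJ j hj
    subst this
    rw [List.foldl_nil, List.foldl_nil]
    conv_rhs => rw [← image_id (s := X)]
    exact image_congr fun K _ => by simp
  | c :: l, hl, J, hJ, X => by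
    obtain ⟨hcl, hl'⟩ : c ∉ l ∧ l.Nodup := List.nodup_cons.1 hl
    rw [List.foldl_cons, List.foldl_cons]
    have hJ' : ∀ j ∈ J.erase c, j ∈ l := fun j hj => by
      have h1 := mem_erase.1 hj
      exact (List.mem_cons.1 (hJ j h1.2)).resolve_left h1.1
    by_cases hc : c ∈ J
    · -- `τ_J = τ_{J.erase c} ∘ τ_c`
      have hsplit : X.image (fun K => K ∆ J) = (X.image (fun K => K ∆ {c})).image (fun K => K ∆ J.erase c) := by
        rw [image_image]
        refine image_congr fun K _ => ?_
        show K ∆ J = (K ∆ {c}) ∆ J.erase c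
        rw [symmDiff_assoc]; congr 1
        ext x; simp only [mem_symmDiff, mem_singleton, mem_erase]
        constructor
        · intro h; by_cases hx : x = c; exact Or.inl ⟨hx, fun h' => h'.1 hx⟩; exact Or.inr ⟨⟨hx, h⟩, hx⟩
        · rintro (⟨rfl, -⟩ | ⟨⟨-, h⟩, -⟩); exact hc; exact h
      rw [hsplit, compression_image_symmDiff (notMem_erase c J), compression_image_symmDiff_self,
        downs_image_symmDiff l hl' (J.erase c) hJ']
    · have hJl : ∀ j ∈ J, j ∈ l := fun j hj => (List.mem_cons.1 (hJ j hj)).resolve_left (fun h => hc (h ▸ hj))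
      rw [compression_image_symmDiff hc, downs_image_symmDiff l hl' J hJl]

/-- Complementation form of σ-invariance: for a duplicate-free list containing EVERY coordinate of a finite type,
`D_l(σX) = D_l X`. [this work] -/
theorem downs_image_compl [Fintype α] (l : List α) (hl : l.Nodup) (hfull : ∀ a, a ∈ l) (X : Finset (Finset α)) :
    l.foldl (fun 𝒴 i => 𝓓 i 𝒴) (X.image compl) = l.foldl (fun 𝒴 i => 𝓓 i 𝒴) X := by
  have : X.image compl = X.image (fun K => K ∆ (univ : Finset α)) :=
    image_congr fun K _ => by
      show Kᶜ = K ∆ univ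
      ext x; simp [mem_symmDiff, mem_compl]
  rw [this]
  exact downs_image_symmDiff l hl univ (fun j _ => hfull j) X


end SahiFComb.Shift

end Summit.CriticalPhenomena.PercolationContinuityZ3.Theorems
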